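import Summits.QuantumFields.YangMills.Theorems.MirrorModularBoostsPlanarSpectralCone
import Summits.QuantumFields.YangMills.Theorems.CurvatureBoostCovariance.Negative.Unbundled
import Summits.QuantumFields.YangMills.Theorems.NPointIsotropy.Negative.NPointRegularJunk
import Literature.Analysis.Complex.ConeTubeIdentity
import Literature.Analysis.OperatorTheory.SesquilinearExtension

/-!
# The operator cone family `N(t, b) = e^{-tH + ibP₁}` on the planar tube — stub `stub_coneFamily`

Line `Sketch` of crux `MirrorModularBoosts.SoftKernelBoostCovariance` (stmt-QuantumFields-14999), stub (N) of the
registered skeleton `Cruxes/SoftKernelBoostCovariance/Lines/Sketch.lean`.  Model-blind operator theory over the landed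
operator cone of item 9664 (`Theorems/MirrorModularBoostsPlanarSpectralCone*.lean`).

**Statement.**  For a one-species Schwinger family `S₁` on `ℝ⁴` with E0' (`HasLinearGrowth`), E3 (`IsSymmetric`),
translations on `⁰𝒮` (`Translations`) and reflection positivity in the eight planar frames (`EightFrameRP`), and any
`e₀`-reconstruction `h` (`OSReconstructionNoE1`: Hilbert space `h.Hilbert`, `h.transfer t = e^{-tH}`,
`h.translate a = U(a⃗)`), there is an operator family `N : ℂ × ℂ → B(ℋ)` with `‖N p‖ ≤ 1` on the planar tube
`𝒯 = {(t, b) : |Im b| < Re t}`, weakly holomorphic matrix elements `p ↦ ⟪ψ, N p ψ'⟫` on `𝒯`, and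
`N(t, b) = e^{-tH} U(b e₁)` at the real points `t > 0`, `b ∈ ℝ`.

**Proof.**
1. The operator cone: `PositivityDiscToOperatorCone.planarConeSupport_of_parts` fed with the four landed stubs
   `stub_discSections`, `stub_cone_of_discSections`, `stub_density`, `stub_linearity` of item 9664 gives
   `μ {p | p₀ < |p₁|} = 0` for every joint spectral measure `μ` of every vector of `h.Hilbert` (the hypotheses
   `Translations S₁` / `EightFrameRP S₁` are definitionally its `htr` / `hRP`).
2. `Contraction.contractionFamily h hcone ψ ψ'` (file `…PlanarSpectralConeTransfer`) then gives, for EVERY pair of vectors,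
   a scalar continuation `Φ_{ψ,ψ'}` holomorphic on `𝒯` with `Φ_{ψ,ψ'}(t, b) = ⟪ψ, e^{-tH} U(b e₁) ψ'⟫` at real points and
   `‖Φ_{ψ,ψ'}‖ ≤ ‖ψ‖ ‖ψ'‖` on `𝒯`.
3. Abstract packaging (`exists_coneFamily_of_continuations`): by the identity theorem on the cone tube
   (`Literature.Analysis.Complex.eqOn_coneTube_of_eq_ofReal`, slices from `DifferentiableOn.coneTube_slice_fst/snd`)
   the continuations are sesquilinear in `(ψ, ψ')` at every point of `𝒯`, because they are at the real points, where
   they are genuine matrix elements of the linear maps `e^{-tH} U(b e₁)`; so `(ψ, ψ') ↦ Φ_{ψ,ψ'}(p)` is a bounded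
   sesquilinear form of norm `≤ 1`, and Riesz representation (`Literature.Analysis.OperatorTheory.IsSesqForm.operator`,
   Mathlib's `InnerProductSpace.continuousLinearMapOfBilin`) gives `N p` with `⟪ψ, N p ψ'⟫ = Φ_{ψ,ψ'}(p)` and
   `‖N p‖ ≤ 1`; at real points `⟪ψ, N(t, b) ψ'⟫ = ⟪ψ, e^{-tH} U(b e₁) ψ'⟫` for all `ψ` forces
   `N(t, b) ψ' = e^{-tH} U(b e₁) ψ'`.

References: J. Glimm, A. Jaffe, *Quantum Physics* (2nd ed. 1987), §19.5 (the holomorphic semigroup `e^{-tH + iyP}`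
on the light-cone tube); K. Osterwalder, R. Schrader, CMP 42 (1975), §V.
-/

noncomputable section

namespace Summit.QuantumFields.YangMills.Theorems.SoftKernelBoostCovariance.Sketch

open MeasureTheory
open scoped InnerProductSpace SchwartzMap ComplexConjugate
open Literature.MathematicalPhysics.QuantumLattice Literature.MathematicalPhysics.AQFT
  Literature.MathematicalPhysics.QuantumFieldTheory
open Literature.Analysis.Complex Literature.Analysis.OperatorTheory
open Summit.QuantumFields.YangMills.Theorems.NPointIsotropy.Negative (E4)
open Summit.QuantumFields.YangMills.Theorems.CurvatureBoostCovariance.Negative (Translations EightFrameRP)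
open Summit.QuantumFields.YangMills.Cruxes.PlanarSpectralCone.PositivityDiscToOperatorCone
  (planarConeSupport_of_parts stub_discSections stub_cone_of_discSections stub_density stub_linearity)
open Summit.QuantumFields.YangMills.Cruxes.PlanarSpectralCone.PositivityDiscToOperatorCone.Contraction
  (contractionFamily)

/-- **Identity theorem on the planar tube for jointly holomorphic functions**: two functions holomorphic on
`𝒯 = {(t, b) : |Im b| < Re t}` that agree at the real points `t > 0`, `b ∈ ℝ` agree on `𝒯`
(`eqOn_coneTube_of_eq_ofReal` with the slices `DifferentiableOn.coneTube_slice_fst/snd`). -/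
theorem eq_on_coneTube_of_eq_ofReal {f g : ℂ × ℂ → ℂ}
    (hf : DifferentiableOn ℂ f {p : ℂ × ℂ | |p.2.im| < p.1.re})
    (hg : DifferentiableOn ℂ g {p : ℂ × ℂ | |p.2.im| < p.1.re})
    (hfg : ∀ t b : ℝ, 0 < t → f ((t : ℂ), (b : ℂ)) = g ((t : ℂ), (b : ℂ))) :
    ∀ p : ℂ × ℂ, |p.2.im| < p.1.re → f p = g p :=
  eqOn_coneTube_of_eq_ofReal (fun t _ => hf.coneTube_slice_snd t) (fun t _ => hg.coneTube_slice_snd t)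
    (fun y => hf.coneTube_slice_fst y) (fun y => hg.coneTube_slice_fst y) hfg

/-- **Abstract packaging: holomorphic contraction family from scalar continuations.**  Let `H` be a complex
Hilbert space, `V t b : H → H` linear maps (`t, b ∈ ℝ`), and suppose that for every pair `x, y ∈ H` a function
`Φ x y` holomorphic on the tube `𝒯 = {|Im b| < Re t}` is given with `Φ x y (t, b) = ⟪x, V t b y⟫` at the real
points `t > 0` and `‖Φ x y p‖ ≤ ‖x‖ ‖y‖` on `𝒯`.  Then there are operators `N p` with `‖N p‖ ≤ 1` on `𝒯`,
holomorphic matrix elements `p ↦ ⟪x, N p y⟫` on `𝒯`, and `N (t, b) = V t b` at the real points `t > 0`.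
(Sesquilinearity of `(x, y) ↦ Φ x y p` by the identity theorem on the tube from the real points; Riesz.) -/
theorem exists_coneFamily_of_continuations {H : Type*} [NormedAddCommGroup H] [InnerProductSpace ℂ H]
    [CompleteSpace H] (V : ℝ → ℝ → H → H)
    (hVadd : ∀ (t b : ℝ) (y y' : H), V t b (y + y') = V t b y + V t b y')
    (hVsmul : ∀ (t b : ℝ) (c : ℂ) (y : H), V t b (c • y) = c • V t b y)
    (Φ : H → H → ℂ × ℂ → ℂ)
    (hΦd : ∀ x y : H, DifferentiableOn ℂ (Φ x y) {w : ℂ × ℂ | |w.2.im| < w.1.re})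
    (hΦr : ∀ (x y : H) (t b : ℝ), 0 < t → Φ x y ((t : ℂ), (b : ℂ)) = ⟪x, V t b y⟫_ℂ)
    (hΦb : ∀ x y : H, ∀ w ∈ {w : ℂ × ℂ | |w.2.im| < w.1.re}, ‖Φ x y w‖ ≤ ‖x‖ * ‖y‖) :
    ∃ N : ℂ × ℂ → (H →L[ℂ] H),
      (∀ p : ℂ × ℂ, |p.2.im| < p.1.re → ‖N p‖ ≤ 1) ∧
      (∀ x y : H, DifferentiableOn ℂ (fun p : ℂ × ℂ => ⟪x, N p y⟫_ℂ) {p : ℂ × ℂ | |p.2.im| < p.1.re}) ∧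
      (∀ (t b : ℝ), 0 < t → ∀ y : H, N ((t : ℂ), (b : ℂ)) y = V t b y) := by
  -- sesquilinearity on the tube, from the real points
  have hadd_left : ∀ (x x' y : H) (p : ℂ × ℂ), |p.2.im| < p.1.re →
      Φ (x + x') y p = Φ x y p + Φ x' y p :=
    fun x x' y => eq_on_coneTube_of_eq_ofReal (hΦd _ _) ((hΦd x y).fun_add (hΦd x' y))
      fun t b ht => by rw [hΦr _ _ t b ht, hΦr _ _ t b ht, hΦr _ _ t b ht, inner_add_left]
  have hsmul_left : ∀ (c : ℂ) (x y : H) (p : ℂ × ℂ), |p.2.im| < p.1.re →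
      Φ (c • x) y p = conj c * Φ x y p :=
    fun c x y => eq_on_coneTube_of_eq_ofReal (hΦd _ _) ((hΦd x y).const_mul (conj c))
      fun t b ht => by rw [hΦr _ _ t b ht, hΦr _ _ t b ht, inner_smul_left]
  have hadd_right : ∀ (x y y' : H) (p : ℂ × ℂ), |p.2.im| < p.1.re →
      Φ x (y + y') p = Φ x y p + Φ x y' p :=
    fun x y y' => eq_on_coneTube_of_eq_ofReal (hΦd _ _) ((hΦd x y).fun_add (hΦd x y'))
      fun t b ht => by rw [hΦr _ _ t b ht, hΦr _ _ t b ht, hΦr _ _ t b ht, hVadd, inner_add_right]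
  have hsmul_right : ∀ (c : ℂ) (x y : H) (p : ℂ × ℂ), |p.2.im| < p.1.re →
      Φ x (c • y) p = c * Φ x y p :=
    fun c x y => eq_on_coneTube_of_eq_ofReal (hΦd _ _) ((hΦd x y).const_mul c)
      fun t b ht => by rw [hΦr _ _ t b ht, hΦr _ _ t b ht, hVsmul, inner_smul_right]
  -- the bounded sesquilinear forms `(x, y) ↦ Φ x y p`, `p ∈ 𝒯`
  have hS : ∀ p : ℂ × ℂ, |p.2.im| < p.1.re → IsSesqForm fun x y => Φ x y p := fun p hp =>
    { add_left := fun x x' y => hadd_left x x' y p hp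
      smul_left := fun c x y => hsmul_left c x y p hp
      add_right := fun x y y' => hadd_right x y y' p hp
      smul_right := fun c x y => hsmul_right c x y p hp }
  have hB : ∀ p : ℂ × ℂ, |p.2.im| < p.1.re → ∀ x y : H, ‖Φ x y p‖ ≤ 1 * ‖x‖ * ‖y‖ :=
    fun p hp x y => by rw [one_mul]; exact hΦb x y p hp
  -- Riesz representation at every point of the tube (and `0` outside)
  have hN : ∀ p : ℂ × ℂ, ∃ T : H →L[ℂ] H, |p.2.im| < p.1.re →
      (∀ x y : H, ⟪x, T y⟫_ℂ = Φ x y p) ∧ ‖T‖ ≤ 1 := by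
    intro p
    by_cases hp : |p.2.im| < p.1.re
    · exact ⟨(hS p hp).operator (hB p hp), fun _ =>
        ⟨(hS p hp).inner_operator (hB p hp), (hS p hp).opNorm_operator_le zero_le_one (hB p hp)⟩⟩
    · exact ⟨0, fun h => absurd h hp⟩
  choose N hN using hN
  refine ⟨N, fun p hp => (hN p hp).2, fun x y => (hΦd x y).congr fun p hp => (hN p hp).1 x y,
    fun t b ht y => ?_⟩
  -- the real points
  have hp : |((b : ℂ)).im| < ((t : ℂ)).re := by simpa using ht
  refine ext_inner_left ℂ fun x => ?_
  rw [(hN ((t : ℂ), (b : ℂ)) hp).1 x y, hΦr x y t b ht]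

/-- **Stub (N) — THE OPERATOR CONE FAMILY (model-blind).**  For a one-species family with E0', E3, translations on
`⁰𝒮` and reflection positivity in the eight planar frames, and any `e₀`-reconstruction `h` (`OSReconstructionNoE1`:
`h.Hilbert`, `h.transfer t = e^{-tH}`, `h.translate a = U(a⃗)`), there is an operator family `N : ℂ × ℂ → B(ℋ)` on the
planar tube `{|Im b| < Re t}` with `‖N p‖ ≤ 1`, weakly holomorphic matrix elements, and `N(t, b) = e^{-tH} U(b e₁)` at
real `t > 0`, `b`.  Proof: the landed operator cone of item 9664 (`planarConeSupport_of_parts` with `stub_discSections`,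
`stub_cone_of_discSections`, `stub_density`, `stub_linearity`) gives `μ {p | p₀ < |p₁|} = 0` for every joint spectral
measure of every vector; `Contraction.contractionFamily` gives the scalar continuations `Φ_{ψ,ψ'}` with
`‖Φ‖ ≤ ‖ψ‖ ‖ψ'‖` for ALL pairs; `exists_coneFamily_of_continuations` packages them into operators by Riesz. -/
theorem stub_coneFamily :
    open Literature.MathematicalPhysics.QuantumLattice Literature.MathematicalPhysics.AQFT
      Literature.MathematicalPhysics.QuantumFieldTheory
      Summit.QuantumFields.YangMills.Theorems.CurvatureBoostCovariance.Negative
      Summit.QuantumFields.YangMills.Theorems.NPointIsotropy.Negative in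
    ∀ (S₁ : SchwingerFamily E4) (h : OSReconstructionNoE1 S₁.toLabelled),
      S₁.toLabelled.HasLinearGrowth → S₁.toLabelled.IsSymmetric → Translations S₁ → EightFrameRP S₁ →
        ∃ N : ℂ × ℂ → (h.Hilbert →L[ℂ] h.Hilbert),
          (∀ p : ℂ × ℂ, |p.2.im| < p.1.re → ‖N p‖ ≤ 1) ∧
          (∀ ψ ψ' : h.Hilbert, DifferentiableOn ℂ (fun p : ℂ × ℂ => ⟪ψ, N p ψ'⟫_ℂ) {p : ℂ × ℂ | |p.2.im| < p.1.re}) ∧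
          (∀ (t b : ℝ), 0 < t → ∀ ψ : h.Hilbert,
            N ((t : ℂ), (b : ℂ)) ψ = h.transfer t (h.translate (b • EuclideanSpace.single 1 1) ψ)) := by
  intro S₁ h hlg hsym htr hRP
  -- the operator cone of item 9664
  have hcone : ∀ (ψ : h.Hilbert) (μ : Measure E4), h.IsJointSpectralMeasure ψ μ → μ {p | p 0 < |p 1|} = 0 :=
    fun ψ μ hμ => planarConeSupport_of_parts stub_discSections stub_cone_of_discSections stub_density
      stub_linearity S₁ hlg hsym htr hRP h ψ μ hμ
  -- the scalar continuations for all pairs of vectors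
  choose Φ hΦd hΦr hΦb using fun ψ ψ' : h.Hilbert => contractionFamily h hcone ψ ψ'
  -- Riesz packaging
  exact exists_coneFamily_of_continuations
    (fun t b ψ => h.transfer t (h.translate (b • EuclideanSpace.single 1 1) ψ))
    (fun t b y y' => by simp only [map_add])
    (fun t b c y => by simp only [LinearIsometryEquiv.map_smul, ContinuousLinearMap.map_smul])
    Φ hΦd hΦr hΦb

end Summit.QuantumFields.YangMills.Theorems.SoftKernelBoostCovariance.Sketch

end
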